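import Summits.ABC.IUTFork.Cor312GapWitnessProvenance
import HarnessLib

/-!
# [IUTchIII] Cor. 3.12 — (Ind1),(Ind2)-STABLE nested hull-sets on the `ℚ`-line packets (toolkit for the re-gluing witness)

Record-only file (D-0012) of the abc-iut cell (Cor. 3.12 cone, D-0067; companion of `Cor312GlueReglue`, wave-5 seat
abc-iut-w5-d177); TAKES NO SIDE; toy constructions and theorems over `GapWitnessProv.lineShells` (the nontrivial
`ℚ`-line packets over an ARBITRARY index skeleton `T`), no `Prop` fact:
* `coord` — the coordinate functional (product over the capsule of the coordinates at a chosen `v | v_ℚ`);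
  **`coord_indGroup`**: EVERY element of the group generated by (Ind1), (Ind2) preserves it (the (Ind1) permutations
  of capsule indices permute the factors of a product; the strip- and Ism-automorphisms of `lineShells` are
  identities) — so every `coord`-defined region is (Ind1),(Ind2)-STABLE (`image_eq_of_mem_closure`);
* `ball n` — the nested regions `{z | |coord z|·2ⁿ ≤ 1}`; `rank`; `frame` — a genuine `HullFrame` on the balls and the
  packet (hull of `U` = the smallest ball containing `U`, resp. the packet); `vol v_ℚ⁰` — the log-volume
  `−1 − rank` at `v_ℚ⁰` (`0` elsewhere), monotone on regions escaping some ball, with `vol (ball n) = −1 − n → −∞`.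
Used by `Cor312GlueReglueWitness` to show the hypotheses of `Cor312GlueReglue.exists_reglue_not_statement` are
satisfiable together with the typed Theorem 3.11. [claim: Mochizuki2012, status: disputed]
-/


noncomputable section

open scoped Classical

namespace Summit.ABC

namespace IUTFork

namespace Cor312Vol

namespace GlueReglueBalls

open Thm311 Cor312 Cor312.Checks Cor312.Setting Cor312Vol.GapWitness Cor312Vol.GapWitnessProv
  Literature.IUT.LogThetaLattice

variable {T : ThetaIndex}

/-! ## 1. The coordinate functional and its invariance under (Ind1), (Ind2) -/

/-- A chosen valuation `v | v_ℚ` (every fibre is nonempty). [folklore] -/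
def pt (vQ : T.VQ) : T.Fibre vQ := ⟨(T.fibre_nonempty vQ).choose, (T.fibre_nonempty vQ).choose_spec⟩

/-- The coordinate functional of the `(j+1)`-tensor packet: product over the capsule of the `pt v_ℚ`-coordinates
(`GapWitnessProv.packetCoord` at the chosen valuation). [folklore] -/
def coord (j : T.Label) (vQ : T.VQ) : (lineShells T).Packet j vQ →ₗ[ℚ] ℚ := packetCoord j vQ (pt vQ)

/-- The `pt v_ℚ`-coordinate of a vector of the 1-tensor packet `⊕_{v | v_ℚ} ℚ`, as a rational number. [folklore] -/
def crd (vQ : T.VQ) (x : (lineShells T).Packet1 vQ) : ℚ := x (pt vQ)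

/-- `coord` of a pure tensor is the product of the coordinates. [folklore] -/
theorem coord_tprod (j : T.Label) (vQ : T.VQ) (g : T.Caps j → (lineShells T).Packet1 vQ) :
    coord j vQ (PiTensorProduct.tprod ℚ g) = ∏ i, crd vQ (g i) := by
  unfold coord packetCoord
  rw [LinearMap.comp_apply]
  erw [PiTensorProduct.map_tprod]
  change (PiTensorProduct.constantBaseRingEquiv (T.Caps j) ℚ)
      (PiTensorProduct.tprod ℚ fun i : T.Caps j => crd vQ (g i)) = _
  rw [PiTensorProduct.constantBaseRingEquiv_tprod]

/-- The all-ones pure tensor `e` has `coord e = 1`. [folklore] -/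
theorem coord_one (j : T.Label) (vQ : T.VQ) :
    coord j vQ ((lineShells T).tprod j vQ fun _ _ => (1 : ℚ)) = 1 :=
  packetCoord_tprod_one j vQ (pt vQ)

/-- `coord` is invariant under the (Ind1) permutations of the capsule indices. [folklore] -/
theorem coord_permute (j : T.Label) (vQ : T.VQ) (σ : Equiv.Perm (T.Caps j))
    (z : (lineShells T).Packet j vQ) : coord j vQ ((lineShells T).permute j vQ σ z) = coord j vQ z := by
  have h : (coord j vQ) ∘ₗ ((lineShells T).permute j vQ σ).toLinearMap = coord j vQ := by
    apply PiTensorProduct.ext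
    ext g
    simp only [LinearMap.compMultilinearMap_apply]
    show coord j vQ ((lineShells T).permute j vQ σ (PiTensorProduct.tprod ℚ g)) =
      coord j vQ (PiTensorProduct.tprod ℚ g)
    rw [show (lineShells T).permute j vQ σ (PiTensorProduct.tprod ℚ g) =
        PiTensorProduct.tprod ℚ (fun i => g (σ.symm i)) from PiTensorProduct.reindex_tprod σ g]
    exact (coord_tprod j vQ _).trans ((Equiv.prod_comp σ.symm fun i => crd vQ (g i)).trans
      (coord_tprod j vQ g).symm)
  exact congrArg (fun f : (lineShells T).Packet j vQ →ₗ[ℚ] ℚ => f z) h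

/-- The strip-automorphism families of `lineShells` are identities. [folklore] -/
theorem strip_family_eq_refl {j : T.Label} (h : T.Caps j → ∀ v : T.V, (lineShells T).carrier v ≃ₗ[ℚ]
    (lineShells T).carrier v) (hmem : ∀ i v, h i v ∈ (lineShells T).stripAut v) :
    h = fun _ _ => LinearEquiv.refl ℚ ℚ := by
  funext i v
  exact Set.mem_singleton_iff.mp (hmem i v)

/-- The Ism-automorphism families of `lineShells` are identities. [folklore] -/
theorem ism_family_eq_refl {j : T.Label} {vQ : T.VQ}
    (g : T.Caps j → ∀ v : T.Fibre vQ, (lineShells T).carrier v.1 ≃ₗ[ℚ] (lineShells T).carrier v.1)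
    (hmem : ∀ i v, g i v ∈ (lineShells T).ism v.1) :
    g = fun _ _ => LinearEquiv.refl ℚ ℚ := by
  funext i v
  exact Set.mem_singleton_iff.mp (hmem i v)

/-- An (Ind1)-family acts on each packet of `lineShells` as a permutation of the factors. [folklore] -/
theorem ind1_apply {Φ : (lineShells T).PacketAut} (hΦ : Φ ∈ (lineShells T).Ind1Family) (j : T.Label)
    (vQ : T.VQ) : ∃ σ : Equiv.Perm (T.Caps j), Φ j vQ = (lineShells T).permute j vQ σ := by
  obtain ⟨σ, h, hmem, hΦj⟩ := hΦ j
  refine ⟨σ, ?_⟩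
  have h1 : Φ j vQ = ((lineShells T).permute j vQ σ).trans ((lineShells T).factorwise j vQ fun i =>
      (lineShells T).summandwise vQ fun v => h i v.1) := hΦj vQ
  rw [h1, strip_family_eq_refl h hmem]
  change ((lineShells T).permute j vQ σ).trans ((lineShells T).factorwise j vQ fun _ =>
    (lineShells T).summandwise vQ fun v => LinearEquiv.refl ℚ ((lineShells T).carrier v.1)) = _
  rw [(lineShells T).summandwise_refl_family j vQ, (lineShells T).factorwise_refl j vQ]
  rfl

/-- An (Ind2)-family acts on each packet of `lineShells` as the identity. [folklore] -/
theorem ind2_apply {Φ : (lineShells T).PacketAut} (hΦ : Φ ∈ (lineShells T).Ind2Family) (j : T.Label)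
    (vQ : T.VQ) : Φ j vQ = LinearEquiv.refl ℚ _ := by
  obtain ⟨g, hmem, hΦj⟩ := hΦ j vQ
  rw [hΦj, ism_family_eq_refl g hmem]
  change ((lineShells T).factorwise j vQ fun _ =>
    (lineShells T).summandwise vQ fun v => LinearEquiv.refl ℚ ((lineShells T).carrier v.1)) = _
  rw [(lineShells T).summandwise_refl_family j vQ, (lineShells T).factorwise_refl j vQ]

/-- **`coord` is preserved by EVERY element of the group generated by (Ind1), (Ind2)** (the `Subgroup.closure`
defining `Setting.indGroup` of any situation on `lineShells`), by closure induction. [folklore] -/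
theorem coord_indGroup {Φ : (lineShells T).PacketAut}
    (hΦ : Φ ∈ Subgroup.closure ((lineShells T).Ind1Family ∪ (lineShells T).Ind2Family)) (j : T.Label)
    (vQ : T.VQ) (z : (lineShells T).Packet j vQ) : coord j vQ (Φ j vQ z) = coord j vQ z := by
  revert j vQ z
  refine Subgroup.closure_induction (p := fun Φ _ => ∀ (j : T.Label) (vQ : T.VQ)
      (z : (lineShells T).Packet j vQ), coord j vQ (Φ j vQ z) = coord j vQ z) ?_ ?_ ?_ ?_ hΦ
  · rintro Ψ (hΨ | hΨ) j vQ z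
    · obtain ⟨σ, hσ⟩ := ind1_apply hΨ j vQ
      rw [hσ]
      exact coord_permute j vQ σ z
    · rw [ind2_apply hΨ j vQ]
      rfl
  · intro j vQ z
    rfl
  · intro Ψ Ψ' _ _ hΨ hΨ' j vQ z
    rw [Pi.mul_apply, Pi.mul_apply, LinearEquiv.mul_apply, hΨ, hΨ']
  · intro Ψ _ hΨ j vQ z
    show coord j vQ ((Ψ j vQ).symm z) = coord j vQ z
    have h := hΨ j vQ ((Ψ j vQ).symm z)
    rw [LinearEquiv.apply_symm_apply] at h
    exact h.symm

/-- Hence every `coord`-defined region is (Ind1),(Ind2)-STABLE: for `Φ` in the generated group,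
`Φ '' {z | p (coord z)} = {z | p (coord z)}`. [folklore] -/
theorem image_eq_of_mem_closure {Φ : (lineShells T).PacketAut}
    (hΦ : Φ ∈ Subgroup.closure ((lineShells T).Ind1Family ∪ (lineShells T).Ind2Family)) (j : T.Label)
    (vQ : T.VQ) (p : ℚ → Prop) :
    Φ j vQ '' {z | p (coord j vQ z)} = {z | p (coord j vQ z)} := by
  ext w
  simp only [Set.mem_image, Set.mem_setOf_eq]
  constructor
  · rintro ⟨z, hz, rfl⟩
    rwa [coord_indGroup hΦ]
  · intro hw
    refine ⟨(Φ j vQ).symm w, ?_, (Φ j vQ).apply_symm_apply w⟩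
    have h := coord_indGroup hΦ j vQ ((Φ j vQ).symm w)
    rw [(Φ j vQ).apply_symm_apply] at h
    rw [h] at hw
    exact hw

/-! ## 2. Nested hull-sets: the `coord`-balls, their rank, the frame and the log-volume -/

/-- The ball `{z | |coord z| · 2ⁿ ≤ 1}` of the packet (`n ∈ ℕ`). [folklore] -/
def ball (j : T.Label) (vQ : T.VQ) (n : ℕ) : Set ((lineShells T).Packet j vQ) :=
  {z | |coord j vQ z| * (2 : ℚ) ^ n ≤ 1}

/-- The balls are nested: `ball n ⊆ ball m` for `m ≤ n`. [folklore] -/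
theorem ball_antitone (j : T.Label) (vQ : T.VQ) {m n : ℕ} (h : m ≤ n) : ball j vQ n ⊆ ball j vQ m := by
  intro z hz
  have h2 : (2 : ℚ) ^ m ≤ (2 : ℚ) ^ n := pow_le_pow_right₀ (by norm_num) h
  have := mul_le_mul_of_nonneg_left h2 (abs_nonneg (coord j vQ z))
  exact le_trans this hz

/-- `0` lies in every ball. [folklore] -/
theorem zero_mem_ball (j : T.Label) (vQ : T.VQ) (n : ℕ) : (0 : (lineShells T).Packet j vQ) ∈ ball j vQ n := by
  simp [ball]

/-- The scaled all-ones tensor `(2ⁿ)⁻¹ • e` lies in `ball n` … [folklore] -/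
theorem smul_one_mem_ball (j : T.Label) (vQ : T.VQ) (n : ℕ) :
    ((2 : ℚ) ^ n)⁻¹ • ((lineShells T).tprod j vQ fun _ _ => (1 : ℚ)) ∈ ball j vQ n := by
  show |coord j vQ (((2 : ℚ) ^ n)⁻¹ • _)| * (2 : ℚ) ^ n ≤ 1
  rw [map_smul, coord_one, smul_eq_mul, mul_one, abs_inv, abs_of_pos (by positivity),
    inv_mul_cancel₀ (by positivity)]

/-- … but not in `ball (n+1)`. [folklore] -/
theorem smul_one_not_mem_ball_succ (j : T.Label) (vQ : T.VQ) (n : ℕ) :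
    ((2 : ℚ) ^ n)⁻¹ • ((lineShells T).tprod j vQ fun _ _ => (1 : ℚ)) ∉ ball j vQ (n + 1) := by
  show ¬ (|coord j vQ (((2 : ℚ) ^ n)⁻¹ • _)| * (2 : ℚ) ^ (n + 1) ≤ 1)
  rw [map_smul, coord_one, smul_eq_mul, mul_one, abs_inv, abs_of_pos (by positivity), pow_succ,
    ← mul_assoc, inv_mul_cancel₀ (by positivity)]
  norm_num

/-- `ball n` is not contained in `ball (n+1)`. [folklore] -/
theorem ball_not_subset_succ (j : T.Label) (vQ : T.VQ) (n : ℕ) : ¬ ball j vQ n ⊆ ball j vQ (n + 1) :=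
  fun h => smul_one_not_mem_ball_succ j vQ n (h (smul_one_mem_ball j vQ n))

/-- The whole packet is contained in no ball (`2 • e` has coordinate `2`). [folklore] -/
theorem univ_not_subset_ball (j : T.Label) (vQ : T.VQ) (n : ℕ) :
    ¬ (Set.univ : Set ((lineShells T).Packet j vQ)) ⊆ ball j vQ n := by
  intro h
  have hz := h (Set.mem_univ ((2 : ℚ) • ((lineShells T).tprod j vQ fun _ _ => (1 : ℚ))))
  change |coord j vQ ((2 : ℚ) • _)| * (2 : ℚ) ^ n ≤ 1 at hz
  rw [map_smul, coord_one, smul_eq_mul, mul_one] at hz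
  have h1 : (1 : ℚ) ≤ (2 : ℚ) ^ n := one_le_pow₀ (by norm_num)
  have : |(2 : ℚ)| = 2 := abs_of_pos (by norm_num)
  rw [this] at hz
  linarith

/-- `ball n ⊆ ball m` iff `m ≤ n`. [folklore] -/
theorem ball_subset_iff (j : T.Label) (vQ : T.VQ) (m n : ℕ) : ball j vQ n ⊆ ball j vQ m ↔ m ≤ n := by
  refine ⟨fun h => ?_, ball_antitone j vQ⟩
  by_contra hmn
  exact ball_not_subset_succ j vQ n (h.trans (ball_antitone j vQ (Nat.succ_le_of_lt (Nat.lt_of_not_le hmn))))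

/-- The set of indices of balls containing `A`. [folklore] -/
def ballIdx (j : T.Label) (vQ : T.VQ) (A : Set ((lineShells T).Packet j vQ)) : Set ℕ := {n | A ⊆ ball j vQ n}

/-- The indices of balls containing `A` form a down-set. [folklore] -/
theorem ballIdx_lower {j : T.Label} {vQ : T.VQ} {A : Set ((lineShells T).Packet j vQ)} {m n : ℕ} (h : m ≤ n)
    (hn : n ∈ ballIdx j vQ A) : m ∈ ballIdx j vQ A :=
  fun _ hz => ball_antitone j vQ h (hn hz)

/-- If `A` escapes `ball n₀`, every ball containing `A` has index `< n₀`; in particular the index set is bounded.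
[folklore] -/
theorem ballIdx_lt {j : T.Label} {vQ : T.VQ} {A : Set ((lineShells T).Packet j vQ)} {n₀ : ℕ}
    (h₀ : ¬ A ⊆ ball j vQ n₀) {n : ℕ} (hn : n ∈ ballIdx j vQ A) : n < n₀ := by
  by_contra h
  exact h₀ (ballIdx_lower (Nat.le_of_not_lt h) hn)

/-- The index set of an escaping region is bounded above. [folklore] -/
theorem ballIdx_bddAbove {j : T.Label} {vQ : T.VQ} {A : Set ((lineShells T).Packet j vQ)}
    (hA : ∃ n, ¬ A ⊆ ball j vQ n) : BddAbove (ballIdx j vQ A) := by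
  obtain ⟨n₀, h₀⟩ := hA
  exact ⟨n₀, fun n hn => (ballIdx_lt h₀ hn).le⟩

/-- The RANK of a region: the largest index of a ball containing it (junk `0` if none or all). [folklore] -/
def rank (j : T.Label) (vQ : T.VQ) (A : Set ((lineShells T).Packet j vQ)) : ℕ := sSup (ballIdx j vQ A)

/-- `rank (ball n) = n`. [folklore] -/
theorem rank_ball (j : T.Label) (vQ : T.VQ) (n : ℕ) : rank j vQ (ball j vQ n) = n := by
  have hset : ballIdx j vQ (ball j vQ n) = Set.Iic n := by
    ext m
    exact ball_subset_iff j vQ m n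
  unfold rank
  rw [hset, csSup_Iic]

/-- `rank univ = 0` (no ball contains the packet). [folklore] -/
theorem rank_univ (j : T.Label) (vQ : T.VQ) : rank j vQ (Set.univ : Set ((lineShells T).Packet j vQ)) = 0 := by
  have hset : ballIdx j vQ (Set.univ : Set ((lineShells T).Packet j vQ)) = ∅ :=
    Set.eq_empty_of_forall_notMem fun n hn => univ_not_subset_ball j vQ n hn
  unfold rank
  rw [hset, csSup_empty]
  rfl

/-- The rank is antitone on escaping regions: `A ⊆ B`, `B` escaping some ball ⇒ `rank B ≤ rank A`. [folklore] -/
theorem rank_antitone {j : T.Label} {vQ : T.VQ} {A B : Set ((lineShells T).Packet j vQ)} (hAB : A ⊆ B)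
    (hA : ∃ n, ¬ A ⊆ ball j vQ n) : rank j vQ B ≤ rank j vQ A := by
  have hsub : ballIdx j vQ B ⊆ ballIdx j vQ A := fun n hn => hAB.trans hn
  by_cases hB : (ballIdx j vQ B).Nonempty
  · exact csSup_le_csSup (ballIdx_bddAbove hA) hB hsub
  · rw [Set.not_nonempty_iff_eq_empty] at hB
    unfold rank
    rw [hB, csSup_empty]
    exact bot_le

variable (vQ₀ : T.VQ)

/-- **The log-volume**: `−1 − rank` at `v_ℚ⁰`, `0` elsewhere (so `vol (ball n) = −1 − n`, `vol univ = −1` at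
`v_ℚ⁰`). [folklore] -/
def vol (j : T.Label) (vQ : T.VQ) (A : Set ((lineShells T).Packet j vQ)) : ℝ :=
  if vQ = vQ₀ then -1 - (rank j vQ A : ℝ) else 0

/-- At `v_ℚ⁰`, `vol (ball n) = −1 − n`. [folklore] -/
theorem vol_ball (j : T.Label) (n : ℕ) : vol vQ₀ j vQ₀ (ball j vQ₀ n) = -1 - n := by
  simp [vol, rank_ball]

/-- At `v_ℚ⁰`, `vol univ = −1`. [folklore] -/
theorem vol_univ_self (j : T.Label) : vol vQ₀ j vQ₀ (Set.univ : Set ((lineShells T).Packet j vQ₀)) = -1 := by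
  simp [vol, rank_univ]

/-- Away from `v_ℚ⁰` every region has log-volume `0`. [folklore] -/
theorem vol_of_ne {j : T.Label} {vQ : T.VQ} (h : vQ ≠ vQ₀) (A : Set ((lineShells T).Packet j vQ)) :
    vol vQ₀ j vQ A = 0 := by simp [vol, h]

/-- `vol univ` is `−1` at `v_ℚ⁰` and `0` elsewhere; in all cases `vol univ = if vQ = vQ₀ then −1 else 0`. [folklore] -/
theorem vol_univ (j : T.Label) (vQ : T.VQ) :
    vol vQ₀ j vQ (Set.univ : Set ((lineShells T).Packet j vQ)) = if vQ = vQ₀ then -1 else 0 := by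
  by_cases h : vQ = vQ₀
  · subst h; rw [if_pos rfl, vol_univ_self]
  · rw [if_neg h, vol_of_ne vQ₀ h]

/-- **Monotonicity** on escaping regions: `A ⊆ B`, `A` escaping some ball ⇒ `vol A ≤ vol B`. [folklore] -/
theorem vol_mono {j : T.Label} {vQ : T.VQ} {A B : Set ((lineShells T).Packet j vQ)} (hAB : A ⊆ B)
    (hA : ∃ n, ¬ A ⊆ ball j vQ n) : vol vQ₀ j vQ A ≤ vol vQ₀ j vQ B := by
  unfold vol
  split_ifs
  · have := rank_antitone hAB hA
    have : (rank j vQ B : ℝ) ≤ rank j vQ A := by exact_mod_cast this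
    linarith
  · exact le_rfl

/-- **The hull frame of nested balls**: hull-sets = the balls and the packet; everything relatively compact; a
region admits a hull iff it escapes some ball; the hull of such a region is the smallest ball containing it
(resp. the packet) — a genuine instance of c312-7's `HullFrame` axioms. [folklore] -/
def frame (j : T.Label) (vQ : T.VQ) : HullFrame ((lineShells T).Packet j vQ) where
  Hul := insert Set.univ (Set.range (ball j vQ))
  IsBounded := fun _ => True
  HasHull := fun U => ∃ n, ¬ U ⊆ ball j vQ n
  hul_bounded := fun _ _ => trivial
  bounded_mono := fun _ _ _ _ => trivial
  exists_hul := fun U _ => ⟨Set.univ, Set.mem_insert _ _, Set.subset_univ U⟩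
  hull_mem := fun U _ hU => by
    by_cases h0 : U ⊆ ball j vQ 0
    · -- the index set is nonempty and bounded: the hull is the ball of index `rank U`
      have hne : (ballIdx j vQ U).Nonempty := ⟨0, h0⟩
      have hbdd : BddAbove (ballIdx j vQ U) := ballIdx_bddAbove hU
      have hN : rank j vQ U ∈ ballIdx j vQ U := Nat.sSup_mem hne hbdd
      have heq : ⋂₀ {H | H ∈ insert Set.univ (Set.range (ball j vQ)) ∧ U ⊆ H} = ball j vQ (rank j vQ U) := by
        refine Set.Subset.antisymm (Set.sInter_subset_of_mem ⟨Set.mem_insert_of_mem _ ⟨_, rfl⟩, hN⟩) ?_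
        refine Set.subset_sInter ?_
        rintro H ⟨hH, hUH⟩
        rcases (Set.mem_insert_iff.mp hH) with rfl | ⟨n, rfl⟩
        · exact Set.subset_univ _
        · exact ball_antitone j vQ (le_csSup hbdd hUH)
      rw [heq]
      exact Set.mem_insert_of_mem _ ⟨_, rfl⟩
    · -- no ball contains `U`: the hull is the packet
      have heq : ⋂₀ {H | H ∈ insert Set.univ (Set.range (ball j vQ)) ∧ U ⊆ H} = Set.univ := by
        refine Set.Subset.antisymm (Set.subset_univ _) (Set.subset_sInter ?_)
        rintro H ⟨hH, hUH⟩
        rcases (Set.mem_insert_iff.mp hH) with rfl | ⟨n, rfl⟩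
        · exact le_rfl
        · exact absurd (hUH.trans (ball_antitone j vQ (Nat.zero_le n))) h0
      rw [heq]
      exact Set.mem_insert _ _

/-- The hull-sets of `frame`: the packet or a ball. [folklore] -/
theorem mem_frame_hul_iff {j : T.Label} {vQ : T.VQ} (H : Set ((lineShells T).Packet j vQ)) :
    H ∈ (frame j vQ).Hul ↔ H = Set.univ ∨ ∃ n, ball j vQ n = H :=
  Set.mem_insert_iff

/-- The packet hull of the whole packet is the whole packet. [folklore] -/
theorem frame_hull_univ (j : T.Label) (vQ : T.VQ) :
    (frame j vQ).hull (Set.univ : Set ((lineShells T).Packet j vQ)) = Set.univ :=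
  Set.Subset.antisymm (Set.subset_univ _) ((frame j vQ).subset_hull _)

end GlueReglueBalls

end Cor312Vol

end IUTFork

end Summit.ABC

end
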